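import Literature.AlgebraicGeometry.Resolution.AlterationsLemma32
import Literature.AlgebraicGeometry.Resolution.AlterationsBoundaryDivisor
import Literature.AlgebraicGeometry.Resolution.AlterationsIsNormalFormParts
import Literature.AlgebraicGeometry.Resolution.RegularLocalRingsUFD
import Literature.AlgebraicGeometry.Resolution.AdicCompletionRegular
import Literature.AlgebraicGeometry.Motives.CyclesEquivalencesProofs
import Mathlib.AlgebraicGeometry.AlgClosed.Basic
import Mathlib.RingTheory.KrullDimension.NonZeroDivisors
import Mathlib.RingTheory.UniqueFactorizationDomain.Ideal
import HarnessLib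

/-!
# De Jong's alteration theorem: "`τᵢ(Y)` is a divisor" — PROVED (de Jong 1996, 4.24)

Topic: `Literature/AlgebraicGeometry/Resolution`. Discharge of the named facts
`DeJong1996SectionIsDivisor` (`AlterationsBoundaryDivisor.lean`) and, with it,
`DeJong1996SemiStableBoundaryIsDivisor` (B1 of `AlterationsIsNormalFormParts.lean`): for a pair
in Situation 4.23 (`DeJong1996.SemiStablePair f g D τ`) over an algebraically closed field, the
image of each section `τᵢ : Y → X` — a section of the semi-stable curve `f` landing in its smooth
locus — is the support of an effective Cartier divisor, namely of the kernel ideal sheaf of the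
closed immersion `τᵢ`; hence the boundary `Z = ⋃ᵢ τᵢ(Y) ∪ f⁻¹(D)` is a divisor ("Furthermore, it
is a divisor, as `D` is a divisor and `τᵢ(Y)` is a divisor", p. 75).

The proof, at a closed point `x = τᵢ(y)`:

* `B = 𝒪_{X,x}` is a regular local ring (3.1, `SemiStablePair.isRegularLocalRing_stalk_apply`),
  hence a factorial domain;
* the stalk of `ker τᵢ` at `x` is the kernel `P` of the surjection `B → A = 𝒪_{Y,y}`
  (`stalkIdeal_ker_eq_ker_stalkMap`: localization is exact), a prime with `B/P ≅ A`;
* `dim B = dim A + 1` (`SemiStablePair.ringKrullDim_stalk_eq_add_one`): the dimension formula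
  for the flat `f` (EGA IV₂ 6.1.2, `Literature.AlgebraicGeometry.Motives.coheight_eq_coheight_add_ringKrullDim_stalk_fiber`)
  and `dim 𝒪_{X_{f x}, x} = 1` (`SemiStablePair.ringKrullDim_stalk_fiber_eq_one`): `f x` is a
  closed point with algebraically closed residue field (Mathlib's `residueFieldIsoBase`), so
  `X_{f x}` is a geometric fibre of the semi-stable curve, whose closed points are nonsingular
  points of a curve or ordinary double points (2.21), and `x` is not a double point because the
  fibre of the smooth open `U ⊇ τᵢ(Y)` is smooth over `κ(f x)`, hence regular at `x`
  (`isRegularLocalRing_stalk_fiber_of_smooth`, EGA IV₄ 17.5.8 (iii)), while the completion of a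
  regular local ring is a domain and `K⟦u, v⟧/(uv)` is not
  (`IsOrdinaryDoublePoint.not_of_isRegularLocalRing`);
* so `P` is a non-zero prime of the factorial domain `B` with `dim B/P = dim B - 1`, hence
  principal (`Ideal.exists_eq_span_singleton_of_ringKrullDim_quotient`: a prime element `p ∈ P`
  with `(p) ⊊ P` would force `dim B/P ≤ dim B - 2`);
* closed points suffice on the Jacobson scheme `X`
  (`isEffectiveCartier_of_stalkIdeal_eq_span_singleton_of_isClosed`, from the stalkwise
  criterion of `AlterationsBoundaryDivisor.lean`).

Results: `DeJong1996SectionIsDivisor_holds`, `DeJong1996SemiStableBoundaryIsDivisor_holds`, and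
the target of the owning unit from the remaining leaves,
`DeJong1996SemiStablePairNormalForm.of_lemma32_of_local : DeJong1996Lemma32 →
DeJong1996SemiStableBoundaryNormalCrossings → DeJong1996CodimThreeNodalForm →
DeJong1996CodimThreeSingularComponentsRegular → DeJong1996SemiStablePairNormalForm`.

## Sources

* A. J. de Jong, *Smoothness, semi-stability and alterations*, Publ. Math. IHÉS 83 (1996), 2.21
  (p. 61), 3.1 (p. 62), 4.23–4.24 (p. 75).
* A. Grothendieck, J. Dieudonné, *EGA IV₂* (1965), Cor. 6.1.2 (dimension formula for flat local
  homomorphisms); *EGA IV₄* (1967), Prop. 17.5.8 (iii).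
* The Stacks Project, Tag 01WS (effective Cartier divisors, local description).
-/

noncomputable section

open CategoryTheory CategoryTheory.Limits AlgebraicGeometry TopologicalSpace Topology
  IsLocalRing

namespace Literature.AlgebraicGeometry.Resolution

universe u

open Scheme.IdealSheafData

/-! ## Local algebra: primes of codimension one in a factorial domain are principal -/

/-- Bookkeeping in `WithBot ℕ∞`: `n ≤ d₂`, `d₂ + 1 ≤ d₁`, `d₁ + 1 ≤ n + 1` is impossible.
[folklore] -/
theorem WithBot.ENat.not_chain_three {n : ℕ} {d₁ d₂ : WithBot ℕ∞} (h3 : (n : WithBot ℕ∞) ≤ d₂)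
    (h2 : d₂ + 1 ≤ d₁) (h1 : d₁ + 1 ≤ ((n + 1 : ℕ) : WithBot ℕ∞)) : False := by
  induction d₂ using WithBot.recBotCoe with
  | bot => exact WithBot.not_coe_le_bot _ h3
  | coe b =>
    induction d₁ using WithBot.recBotCoe with
    | bot =>
      rw [← WithBot.coe_one, ← WithBot.coe_add] at h2
      exact WithBot.not_coe_le_bot _ h2
    | coe a =>
      have h1' : a + 1 ≤ ((n + 1 : ℕ) : ℕ∞) := by exact_mod_cast h1
      have h2' : b + 1 ≤ a := by exact_mod_cast h2
      have h3' : (n : ℕ∞) ≤ b := by exact_mod_cast h3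
      induction a using ENat.recTopCoe with
      | top => simp at h1'
      | coe a =>
        induction b using ENat.recTopCoe with
        | top => simp at h2'
        | coe b =>
          have e1 : a + 1 ≤ n + 1 := by exact_mod_cast h1'
          have e2 : b + 1 ≤ a := by exact_mod_cast h2'
          have e3 : n ≤ b := by exact_mod_cast h3'
          omega

/-- In a factorial domain `B` of Krull dimension `n + 1`, a non-zero prime ideal `P` with
`dim B/P = n` is principal, generated by a prime element: `P` contains a prime element `p`, and
if `(p) ⊊ P` then, `B/(p)` being a domain, `dim B/P ≤ dim B/(p) - 1 ≤ dim B - 2`. [folklore] -/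
theorem Ideal.exists_eq_span_singleton_of_ringKrullDim_quotient {B : Type*} [CommRing B]
    [IsDomain B] [UniqueFactorizationMonoid B] (P : Ideal B) [P.IsPrime] (hP : P ≠ ⊥) {n : ℕ}
    (hB : ringKrullDim B = (n + 1 : ℕ)) (hBP : ringKrullDim (B ⧸ P) = n) :
    ∃ p : B, Prime p ∧ P = Ideal.span {p} := by
  obtain ⟨p, hpP, hp⟩ := Ideal.IsPrime.exists_mem_prime_of_ne_bot ‹_› hP
  refine ⟨p, hp, ?_⟩
  by_contra hne
  have hlt : Ideal.span {p} < P :=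
    lt_of_le_of_ne ((Ideal.span_singleton_le_iff_mem _).mpr hpP) (Ne.symm hne)
  obtain ⟨r, hrP, hrp⟩ := SetLike.exists_of_lt hlt
  haveI : (Ideal.span {p}).IsPrime := (Ideal.span_singleton_prime hp.ne_zero).mpr hp
  haveI : IsDomain (B ⧸ Ideal.span {p}) := Ideal.Quotient.isDomain _
  set r' : B ⧸ Ideal.span {p} := Ideal.Quotient.mk _ r with hr'def
  have hr' : r' ≠ 0 := fun h => hrp (Ideal.Quotient.eq_zero_iff_mem.mp h)
  have h1 : ringKrullDim (B ⧸ Ideal.span {p}) + 1 ≤ ringKrullDim B :=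
    ringKrullDim_quotient_succ_le_of_nonZeroDivisor (mem_nonZeroDivisors_of_ne_zero hp.ne_zero)
  have h2 : ringKrullDim ((B ⧸ Ideal.span {p}) ⧸ Ideal.span {r'}) + 1 ≤
      ringKrullDim (B ⧸ Ideal.span {p}) :=
    ringKrullDim_quotient_succ_le_of_nonZeroDivisor (mem_nonZeroDivisors_of_ne_zero hr')
  -- `B/P` is a quotient of `(B/(p))/(r̄) ≅ B/((p) + (r))`
  have hle : Ideal.span {p} ⊔ Ideal.span {r} ≤ P :=
    sup_le hlt.le ((Ideal.span_singleton_le_iff_mem _).mpr hrP)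
  have hmap : (Ideal.span {r}).map (Ideal.Quotient.mk (Ideal.span {p})) = Ideal.span {r'} := by
    rw [Ideal.map_span, Set.image_singleton]
  have h3 : ringKrullDim (B ⧸ P) ≤ ringKrullDim ((B ⧸ Ideal.span {p}) ⧸ Ideal.span {r'}) := by
    rw [← hmap, ringKrullDim_eq_of_ringEquiv (DoubleQuot.quotQuotEquivQuotSup _ _)]
    exact ringKrullDim_le_of_surjective (Ideal.Quotient.factor hle)
      (Ideal.Quotient.factor_surjective hle)
  -- arithmetic: `n + 2 ≤ n + 1`
  rw [hBP] at h3
  rw [hB] at h1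
  exact WithBot.ENat.not_chain_three h3 h2 h1

/-! ## The germ of the ideal of a closed immersion is the kernel of the stalk map -/

/-- **The stalk of the kernel ideal sheaf of a closed immersion is the kernel of the stalk map**:
for a closed immersion `τ : Y → X` and `y ∈ Y`, `(ker τ)_{τ y} = ker (𝒪_{X,τ y} → 𝒪_{Y,y})`.
(On an affine open `U = Spec R ∋ τ y`, `τ⁻¹U = Spec S` with `R → S` surjective, the stalks are
the localizations at the primes of `τ y` and `y`, and localization is exact.) [folklore] -/
theorem stalkIdeal_ker_eq_ker_stalkMap {X Y : Scheme.{u}} (τ : Y ⟶ X) [IsClosedImmersion τ]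
    (y : Y) : stalkIdeal τ.ker (τ y) = RingHom.ker (τ.stalkMap y).hom := by
  obtain ⟨U, hU, hxU, -⟩ :=
    exists_isAffineOpen_mem_and_subset (X := X) (x := τ y) (U := ⊤) (Opens.mem_top _)
  have hV : IsAffineOpen (τ ⁻¹ᵁ U) := hU.preimage τ
  have hyV : y ∈ τ ⁻¹ᵁ U := hxU
  rw [stalkIdeal_eq_map_germ _ ⟨U, hU⟩ hxU, Scheme.Hom.ker_apply]
  apply le_antisymm
  · rw [Ideal.map_le_iff_le_comap]
    intro s hs
    rw [Ideal.mem_comap, RingHom.mem_ker]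
    rw [RingHom.mem_ker] at hs
    change (τ.stalkMap y) ((X.presheaf.germ U (τ y) hxU) s) = 0
    rw [Scheme.Hom.germ_stalkMap_apply]
    change (Y.presheaf.germ (τ ⁻¹ᵁ U) y hyV) ((τ.app U).hom s) = 0
    rw [hs, map_zero]
  · intro b hb
    rw [RingHom.mem_ker] at hb
    -- `𝒪_{X, τ y}` is the localization of `Γ(X, U)` at the prime of `τ y`
    letI := TopCat.Presheaf.algebra_section_stalk X.presheaf (⟨τ y, hxU⟩ : (U : X.Opens))
    haveI := hU.isLocalization_stalk ⟨τ y, hxU⟩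
    set 𝔭 := (hU.primeIdealOf ⟨τ y, hxU⟩).asIdeal with h𝔭
    obtain ⟨⟨s, t⟩, rfl⟩ := IsLocalization.mk'_surjective 𝔭.primeCompl b
    change (τ.stalkMap y).hom (IsLocalization.mk' _ s t) = 0 at hb
    show IsLocalization.mk' _ s t ∈ _
    have halg : ∀ a : Γ(X, U), algebraMap Γ(X, U) (X.presheaf.stalk (τ y)) a =
        (X.presheaf.germ U (τ y) hxU).hom a := fun a => rfl
    -- `stalkMap (germ s) = 0`
    have hs0 : (τ.stalkMap y).hom ((X.presheaf.germ U (τ y) hxU).hom s) = 0 := by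
      have e := IsLocalization.mk'_spec (X.presheaf.stalk (τ y)) s t
      rw [← halg, ← e, map_mul, hb, zero_mul]
    -- `germ_y (τ^* s) = 0` in `𝒪_{Y,y}`, the localization of `Γ(Y, τ⁻¹U)` at the prime of `y`
    have hs1 : (Y.presheaf.germ (τ ⁻¹ᵁ U) y hyV).hom ((τ.app U).hom s) = 0 := by
      have := Scheme.Hom.germ_stalkMap_apply τ U y hxU s
      exact this ▸ hs0
    letI algY := TopCat.Presheaf.algebra_section_stalk Y.presheaf (⟨y, hyV⟩ : (τ ⁻¹ᵁ U : Y.Opens))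
    haveI := hV.isLocalization_stalk ⟨y, hyV⟩
    set 𝔮 := (hV.primeIdealOf ⟨y, hyV⟩).asIdeal with h𝔮
    have halgY : ∀ a : Γ(Y, τ ⁻¹ᵁ U), algebraMap Γ(Y, τ ⁻¹ᵁ U) (Y.presheaf.stalk y) a =
        (Y.presheaf.germ (τ ⁻¹ᵁ U) y hyV).hom a := fun a => rfl
    rw [← halgY, IsLocalization.map_eq_zero_iff 𝔮.primeCompl (Y.presheaf.stalk y)] at hs1
    obtain ⟨⟨u, hu⟩, hus⟩ := hs1
    -- lift `u` along the surjection `Γ(X, U) → Γ(Y, τ⁻¹U)`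
    obtain ⟨u', rfl⟩ := τ.app_surjective U hU u
    -- `u' ∉ 𝔭` since `𝔭` is the contraction of `𝔮`
    have hcomap : PrimeSpectrum.comap (τ.appLE U (τ ⁻¹ᵁ U) le_rfl).hom (hV.primeIdealOf ⟨y, hyV⟩) =
        hU.primeIdealOf ⟨τ y, hxU⟩ :=
      IsAffineOpen.comap_primeIdealOf_appLE U hU (τ ⁻¹ᵁ U) hV le_rfl hyV
    have hu' : u' ∈ 𝔭.primeCompl := by
      intro hu'𝔭
      apply hu
      have : u' ∈ (PrimeSpectrum.comap (τ.appLE U (τ ⁻¹ᵁ U) le_rfl).hom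
          (hV.primeIdealOf ⟨y, hyV⟩)).asIdeal := by
        rw [hcomap]
        exact hu'𝔭
      rw [PrimeSpectrum.comap_asIdeal, Ideal.mem_comap, ← Scheme.Hom.app_eq_appLE] at this
      exact this
    -- `u' s ∈ ker τ^*`
    have hmem : u' * s ∈ RingHom.ker (τ.app U).hom := by
      rw [RingHom.mem_ker, map_mul]
      exact hus
    have hgerm : algebraMap Γ(X, U) (X.presheaf.stalk (τ y)) (u' * s) ∈
        (RingHom.ker (τ.app U).hom).map (X.presheaf.germ U (τ y) hxU).hom :=
      Ideal.mem_map_of_mem _ hmem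
    have hunit : IsUnit (algebraMap Γ(X, U) (X.presheaf.stalk (τ y)) u') :=
      IsLocalization.map_units (X.presheaf.stalk (τ y)) ⟨u', hu'⟩
    have hsmem : algebraMap Γ(X, U) (X.presheaf.stalk (τ y)) s ∈
        (RingHom.ker (τ.app U).hom).map (X.presheaf.germ U (τ y) hxU).hom := by
      rw [map_mul] at hgerm
      obtain ⟨v, hv⟩ := hunit
      rw [← hv] at hgerm
      have := Ideal.mul_mem_left _ (↑v⁻¹ : X.presheaf.stalk (τ y)) hgerm
      rwa [← mul_assoc, Units.inv_mul, one_mul] at this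
    rw [IsLocalization.mk'_eq_mul_mk'_one]
    exact Ideal.mul_mem_right _ _ hsmem

/-! ## Ordinary double points are not regular; the fibre of a smooth open is regular -/

/-- An ordinary double point is not a regular point: the completion of a regular local ring is
regular, hence a domain, while `K⟦u, v⟧/(uv)` is not. [folklore] -/
theorem IsOrdinaryDoublePoint.not_of_isRegularLocalRing (K : Type u) [Field K] {C : Scheme.{u}}
    {x : C} (hx : IsRegularLocalRing (C.presheaf.stalk x)) : ¬ IsOrdinaryDoublePoint K x := by
  rintro ⟨e⟩
  haveI := hx
  haveI := isRegularLocalRing_adicCompletion (C.presheaf.stalk x)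
  haveI : IsDomain (AdicCompletion (maximalIdeal (C.presheaf.stalk x)) (C.presheaf.stalk x)) :=
    isDomain_of_isRegularLocalRing _
  exact IsOrdinaryDoublePoint.not_isDomain_quotient K (MulEquiv.isDomain _ e.symm.toMulEquiv)

/-- The local rings of the spectrum of a field are regular. [folklore] -/
theorem isRegularLocalRing_stalk_Spec_field (K : Type u) [Field K] (p : ↥(Spec (.of K))) :
    IsRegularLocalRing ((Spec (.of K)).presheaf.stalk p) := by
  haveI : Subsingleton ↥(Spec (CommRingCat.of K)) :=
    inferInstanceAs (Subsingleton (PrimeSpectrum K))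
  have hp : p = closedPoint K := Subsingleton.elim _ _
  subst hp
  haveI : IsRegularLocalRing K := inferInstance
  exact IsRegularLocalRing.of_ringEquiv (stalkClosedPointIso (.of K)).commRingCatIsoToRingEquiv.symm

/-- **The fibre through a point of an open on which `f` is smooth is regular at that point**:
`U ×_Y Spec κ(f x) → X ×_Y Spec κ(f x)` is an open immersion through `x`, and the source is
smooth over the field `κ(f x)`, hence regular (EGA IV₄ 17.5.8 (iii)). [folklore] -/
theorem isRegularLocalRing_stalk_fiber_of_smooth {X Y : Scheme.{u}} (f : X ⟶ Y) {U : X.Opens}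
    (hU : Smooth (U.ι ≫ f)) {x : X} (hxU : x ∈ U) :
    IsRegularLocalRing ((f.fiber (f x)).presheaf.stalk (f.asFiber x)) := by
  haveI := hU
  set s := Y.fromSpecResidueField (f x) with hs
  let j : pullback (U.ι ≫ f) s ⟶ pullback f s :=
    pullback.map (U.ι ≫ f) s f s U.ι (𝟙 _) (𝟙 Y) (by simp) (by simp)
  have hx' : (f.asFiber x : ↥(pullback f s)) ∈ Set.range j := by
    rw [Scheme.Pullback.range_map]
    refine ⟨?_, ?_⟩
    · show pullback.fst f s (f.asFiber x) ∈ Set.range U.ι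
      rw [Scheme.Opens.range_ι]
      change f.fiberι (f x) (f.asFiber x) ∈ U
      rw [Scheme.Hom.fiberι_asFiber]
      exact hxU
    · show pullback.snd f s (f.asFiber x) ∈ Set.range (𝟙 (Spec (Y.residueField (f x))))
      simp
  obtain ⟨z, hz⟩ := hx'
  haveI : IsRegularLocalRing ((pullback (U.ι ≫ f) s).presheaf.stalk z) :=
    isRegularLocalRing_stalk_of_smooth (pullback.snd (U.ι ≫ f) s) z
      (isRegularLocalRing_stalk_Spec_field _ _)
  have e := (asIso (j.stalkMap z)).commRingCatIsoToRingEquiv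
  rw [← hz]
  exact IsRegularLocalRing.of_ringEquiv e.symm

/-! ## The fibre dimension at a closed point of a section, and `dim 𝒪_{X,x} = dim 𝒪_{Y,f x} + 1` -/

namespace DeJong1996.SemiStablePair

variable {k : Type u} [Field k] {X Y : Scheme.{u}} {f : X ⟶ Y} {g : Y ⟶ Spec (.of k)}
  {D : Set Y} {n : ℕ} {τ : Fin n → (Y ⟶ X)}

/-- In Situation 4.23 over an algebraically closed field, at a closed point `x` of an open on
which `f` is smooth, the fibre `X_{f(x)}` has a one-dimensional local ring at `x`: `f(x)` is a
closed point with algebraically closed residue field, so `X_{f(x)}` is a geometric fibre of the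
semi-stable curve, whose closed points are nonsingular points of a curve or nodes — and `x` is
not a node, the fibre being smooth, hence regular, there. [cite: DeJong1996, 2.21, p. 61] -/
theorem ringKrullDim_stalk_fiber_eq_one [IsAlgClosed k] (hS : SemiStablePair f g D τ)
    {U : X.Opens} (hU : Smooth (U.ι ≫ f)) {x : X} (hxU : x ∈ U) (hx : IsClosed ({x} : Set X)) :
    ringKrullDim ((f.fiber (f x)).presheaf.stalk (f.asFiber x)) = 1 := by
  haveI := hS.isSemiStableCurve.isProper
  have hy : IsClosed ({f x} : Set Y) := by
    rw [← Set.image_singleton]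
    exact f.isClosedMap _ hx
  haveI : IsProper g :=
    Literature.AlgebraicGeometry.Motives.IsProjectiveOver.isProper (X := Over.mk g)
      hS.isProjectiveOver_base
  haveI : IsAlgClosed (Y.residueField (f x)) :=
    IsAlgClosed.of_ringEquiv k _ (residueFieldIsoBase g (f x) hy).commRingCatIsoToRingEquiv.symm
  -- the point of the fibre over `x` is closed
  have hx' : IsClosed ({f.asFiber x} : Set ↥(f.fiber (f x))) := by
    have e : ({f.asFiber x} : Set ↥(f.fiber (f x))) = f.fiberι (f x) ⁻¹' {x} := by
      ext z
      simp only [Set.mem_singleton_iff, Set.mem_preimage]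
      constructor
      · rintro rfl
        exact f.fiberι_asFiber x
      · intro hz
        apply (f.fiberι (f x)).isEmbedding.injective
        rw [hz, f.fiberι_asFiber]
    rw [e]
    exact hx.preimage (f.fiberι (f x)).continuous
  rcases hS.isSemiStableCurve.isRegularLocalRing_or_isOrdinaryDoublePoint (Y.residueField (f x))
      (Y.fromSpecResidueField (f x)) (f.asFiber x) hx' with ⟨-, hdim⟩ | hnode
  · exact hdim
  · exact absurd hnode (IsOrdinaryDoublePoint.not_of_isRegularLocalRing _
      (isRegularLocalRing_stalk_fiber_of_smooth f hU hxU))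

/-- **`dim 𝒪_{X,x} = dim 𝒪_{Y,f(x)} + 1` at a closed point of the smooth locus of the curve of
Situation 4.23** (EGA IV₂ 6.1.2, the dimension formula for the flat `f`, and the fibre dimension
`1`). [cite: GrothendieckDieudonne1965, Cor. (6.1.2), p. 135] -/
theorem ringKrullDim_stalk_eq_add_one [IsAlgClosed k] (hS : SemiStablePair f g D τ)
    {U : X.Opens} (hU : Smooth (U.ι ≫ f)) {x : X} (hxU : x ∈ U) (hx : IsClosed ({x} : Set X)) :
    ringKrullDim (X.presheaf.stalk x) = ringKrullDim (Y.presheaf.stalk (f x)) + 1 := by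
  haveI := hS.isIntegral
  haveI : IsNoetherian X := isNoetherian_of_isProjectiveOver _ hS.isProjectiveOver
  haveI := hS.isNoetherian_base
  haveI := hS.isSemiStableCurve.flat
  have h := Literature.AlgebraicGeometry.Motives.coheight_eq_coheight_add_ringKrullDim_stalk_fiber f x
  rw [hS.ringKrullDim_stalk_fiber_eq_one hU hxU hx] at h
  rw [ringKrullDim_stalk_eq_coheight, ringKrullDim_stalk_eq_coheight]
  exact h

/-- **The germ of the ideal of a section is principal** (the local content of "`τᵢ(Y)` is a
divisor", de Jong 1996, 4.24): at a closed point `x = τᵢ(y)`, the stalk of the kernel ideal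
sheaf of the closed immersion `τᵢ` is generated by one non-zero element of the regular, hence
factorial, local ring `𝒪_{X,x}` — it is the prime `P = ker(𝒪_{X,x} → 𝒪_{Y,y})` with
`dim 𝒪_{X,x}/P = dim 𝒪_{Y,y} = dim 𝒪_{X,x} - 1`. [cite: DeJong1996, 4.24, p. 75] -/
theorem exists_stalkIdeal_ker_eq_span_singleton [IsAlgClosed k] (hS : SemiStablePair f g D τ)
    (i : Fin n) (y : Y) (hy : IsClosed ({τ i y} : Set X)) :
    ∃ p : X.presheaf.stalk (τ i y), p ≠ 0 ∧ stalkIdeal (τ i).ker (τ i y) = Ideal.span {p} := by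
  haveI := hS.isClosedImmersion i
  haveI := hS.isNoetherian_base
  obtain ⟨U, hU, hUf⟩ := hS.exists_smooth i
  have hxU : τ i y ∈ U := hU ⟨y, rfl⟩
  haveI : IsRegularLocalRing (X.presheaf.stalk (τ i y)) := hS.isRegularLocalRing_stalk_apply i y
  haveI : IsDomain (X.presheaf.stalk (τ i y)) := isDomain_of_isRegularLocalRing _
  haveI : UniqueFactorizationMonoid (X.presheaf.stalk (τ i y)) :=
    IsRegularLocalRing.uniqueFactorizationMonoid _
  -- `P = ker (𝒪_{X, τ y} → 𝒪_{Y, y})`, a surjection onto `𝒪_{Y,y}`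
  have hP := stalkIdeal_ker_eq_ker_stalkMap (τ i) y
  have hsurj : Function.Surjective ((τ i).stalkMap y).hom := (τ i).stalkMap_surjective y
  -- dimensions: `dim 𝒪_{Y,y} = m`, `dim 𝒪_{X,τ y} = m + 1`
  obtain ⟨m, hm⟩ := ringKrullDim_eq_nat (Y.presheaf.stalk y)
  have hfy : f (τ i y) = y := by
    rw [← Scheme.Hom.comp_apply, hS.comp_eq_id]
    rfl
  have hB : ringKrullDim (X.presheaf.stalk (τ i y)) = (m + 1 : ℕ) := by
    have h := hS.ringKrullDim_stalk_eq_add_one hUf hxU hy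
    rw [hfy, hm] at h
    rw [h]
    rfl
  have hBP : ringKrullDim (X.presheaf.stalk (τ i y) ⧸ stalkIdeal (τ i).ker (τ i y)) = m := by
    rw [hP, ringKrullDim_eq_of_ringEquiv (RingHom.quotientKerEquivOfSurjective hsurj), hm]
  have hne : stalkIdeal (τ i).ker (τ i y) ≠ ⊥ := by
    intro h0
    rw [h0, ringKrullDim_eq_of_ringEquiv (RingEquiv.quotientBot _), hB] at hBP
    have h1 : ((m + 1 : ℕ) : WithBot ℕ∞) = (m : ℕ) := hBP
    have h2 := ENat.coe_inj.mp (WithBot.coe_inj.mp h1)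
    omega
  haveI : IsDomain (Y.presheaf.stalk y) :=
    haveI := hS.isRegular_base y
    isDomain_of_isRegularLocalRing _
  haveI : (stalkIdeal (τ i).ker (τ i y)).IsPrime := by
    rw [hP]
    exact RingHom.ker_isPrime _
  obtain ⟨p, hp, hPp⟩ := Ideal.exists_eq_span_singleton_of_ringKrullDim_quotient _ hne hB hBP
  exact ⟨p, hp.ne_zero, hPp⟩

end DeJong1996.SemiStablePair

/-! ## Effective Cartier divisors: it suffices to look at closed points -/

/-- On an integral locally Noetherian Jacobson scheme (e.g. a variety), an ideal sheaf whose
stalk at every CLOSED point of its support is principal and non-zero is an effective Cartier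
divisor: every point specialises to a closed point of its closure, which lies in the (closed)
support, and a Cartier chart at that closed point is an open neighbourhood of the original
point. [cite: StacksProject, Tag 01WS] -/
theorem isEffectiveCartier_of_stalkIdeal_eq_span_singleton_of_isClosed {X : Scheme.{u}}
    [IsIntegral X] [IsLocallyNoetherian X] [JacobsonSpace X] {I : X.IdealSheafData}
    (h : ∀ x ∈ I.support, IsClosed ({x} : Set X) →
      ∃ g : X.presheaf.stalk x, g ≠ 0 ∧ stalkIdeal I x = Ideal.span {g}) :
    IsEffectiveCartier I := by
  -- Cartier charts at the closed points of the support
  have key : ∀ x ∈ I.support, IsClosed ({x} : Set X) → ∃ U : X.affineOpens, x ∈ (U : X.Opens) ∧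
      ∃ f : Γ(X, U), f ∈ nonZeroDivisors Γ(X, U) ∧ I.ideal U = Ideal.span {f} := by
    intro x hx hxc
    obtain ⟨U, hU, hxU, -⟩ :=
      exists_isAffineOpen_mem_and_subset (X := X) (x := x) (U := ⊤) (Opens.mem_top x)
    obtain ⟨g, hg0, hIg⟩ := h x hx hxc
    have hspan : Ideal.span ((X.presheaf.germ U x hxU).hom '' (I.ideal ⟨U, hU⟩)) =
        Ideal.span {g} := by
      rw [← hIg, stalkIdeal_eq_map_germ I ⟨U, hU⟩ hxU, Ideal.map]
    obtain ⟨_, ⟨i, hi, rfl⟩, hgen⟩ := exists_mem_span_singleton_eq_of_span_eq hg0 hspan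
    have hIi : stalkIdeal I x = Ideal.span {(X.presheaf.germ U x hxU).hom i} := by
      rw [hgen, hIg]
    have hi0 : (X.presheaf.germ U x hxU).hom i ≠ 0 := by
      intro h0
      rw [h0, Ideal.span_singleton_eq_bot.mpr rfl, eq_comm, Ideal.span_singleton_eq_bot] at hgen
      exact hg0 hgen
    obtain ⟨V, hVU, hxV, hIV⟩ :=
      exists_ideal_eq_span_singleton_of_stalkIdeal_eq I ⟨U, hU⟩ hxU i hi hIi
    refine ⟨V, hxV, _, mem_nonZeroDivisors_of_germ_ne_zero hxV _ ?_, hIV⟩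
    change X.presheaf.germ V x hxV (X.presheaf.map (homOfLE hVU).op i) ≠ 0
    rw [TopCat.Presheaf.germ_res_apply]
    exact hi0
  intro x
  by_cases hx : x ∈ I.support
  · -- a closed point `x₀` of `cl{x} ⊆ Supp I`
    obtain ⟨x₀, hx₀cl, hx₀c⟩ := nonempty_inter_closedPoints (Z := closure {x})
      ⟨x, subset_closure rfl⟩ isClosed_closure.isLocallyClosed
    have hxx₀ : x ⤳ x₀ := specializes_iff_mem_closure.mpr hx₀cl
    have hx₀S : x₀ ∈ I.support :=
      (closure_minimal (Set.singleton_subset_iff.mpr hx) I.support.isClosed) hx₀cl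
    obtain ⟨U, hx₀U, g, hg, hIU⟩ := key x₀ hx₀S hx₀c
    exact ⟨U, hxx₀.mem_open U.1.isOpen hx₀U, g, hg, hIU⟩
  · -- off the support: a section of `I(U)` does not vanish at `x`, and is a unit on `D(f)`
    obtain ⟨U, hU, hxU, -⟩ :=
      exists_isAffineOpen_mem_and_subset (X := X) (x := x) (U := ⊤) (Opens.mem_top x)
    rw [mem_support_iff_of_mem (U := ⟨U, hU⟩) hxU, Scheme.mem_zeroLocus_iff] at hx
    push Not at hx
    obtain ⟨f, hfI, hxf⟩ := hx
    refine ⟨X.affineBasicOpen f, hxf, 1, one_mem _, ?_⟩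
    rw [Ideal.span_singleton_one, eq_top_iff, ← I.map_ideal_basicOpen]
    have hu : IsUnit (X.presheaf.map (homOfLE (X.basicOpen_le f)).op f) := by
      have := hU.isLocalization_basicOpen f
      exact IsLocalization.Away.algebraMap_isUnit (S := Γ(X, X.basicOpen f)) f
    exact (Ideal.eq_top_of_isUnit_mem _ (Ideal.mem_map_of_mem _ hfI) hu).ge

/-! ## "`τᵢ(Y)` is a divisor": the discharge -/

/-- **de Jong 1996, 4.24: "`τᵢ(Y)` is a divisor" — PROVED.** For a pair in Situation 4.23 over an
algebraically closed field, the image of each section `τᵢ` is the support of an effective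
Cartier divisor, namely of the kernel ideal sheaf of the closed immersion `τᵢ`: its support is
`τᵢ(Y)`, and at every closed point `x = τᵢ(y)` its stalk is a non-zero principal ideal of the
factorial local ring `𝒪_{X,x}` (`exists_stalkIdeal_ker_eq_span_singleton`), which suffices on the
Jacobson scheme `X` (`isEffectiveCartier_of_stalkIdeal_eq_span_singleton_of_isClosed`).
[cite: DeJong1996, 4.24, p. 75] -/
theorem DeJong1996SectionIsDivisor_holds : DeJong1996SectionIsDivisor.{u} := by
  intro k _ _ X Y f g D n τ hS i
  haveI := hS.isIntegral
  haveI : IsNoetherian X := DeJong1996.isNoetherian_of_isProjectiveOver _ hS.isProjectiveOver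
  haveI := hS.isClosedImmersion i
  haveI := hS.locallyOfFiniteType
  haveI : JacobsonSpace ↥X := LocallyOfFiniteType.jacobsonSpace (f ≫ g)
  refine ⟨(τ i).ker, isEffectiveCartier_of_stalkIdeal_eq_span_singleton_of_isClosed ?_, ?_⟩
  · intro x hx hxc
    have hx' : x ∈ Set.range (τ i) := by
      have : x ∈ ((τ i).ker.support : Set X) := hx
      rw [Scheme.Hom.support_ker, (τ i).isClosedEmbedding.isClosed_range.closure_eq] at this
      exact this
    obtain ⟨y, rfl⟩ := hx'
    exact hS.exists_stalkIdeal_ker_eq_span_singleton i y hxc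
  · rw [Scheme.Hom.support_ker, (τ i).isClosedEmbedding.isClosed_range.closure_eq]

/-- `DeJong1996SemiStableBoundaryIsDivisor` (B1 of `AlterationsIsNormalFormParts.lean`) from
"`τᵢ(Y)` is a divisor" (`AlterationsBoundaryDivisor.lean`). [cite: DeJong1996, 4.24, p. 75] -/
theorem DeJong1996SemiStableBoundaryIsDivisor.of_sectionIsDivisor
    (h : DeJong1996SectionIsDivisor.{u}) : DeJong1996SemiStableBoundaryIsDivisor.{u} :=
  fun _k _ _ _X _Y _f _g _D _n _τ hS => hS.exists_isEffectiveCartier_semiStableBoundary h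

/-- **de Jong 1996, 4.24, "Furthermore, it is a divisor, as `D` is a divisor and `τᵢ(Y)` is a
divisor" — PROVED**: the boundary `Z = ⋃ᵢ τᵢ(Y) ∪ f⁻¹(D)` of a pair in Situation 4.23 over an
algebraically closed field is the support of an effective Cartier divisor.
[cite: DeJong1996, 4.24, p. 75] -/
theorem DeJong1996SemiStableBoundaryIsDivisor_holds : DeJong1996SemiStableBoundaryIsDivisor.{u} :=
  DeJong1996SemiStableBoundaryIsDivisor.of_sectionIsDivisor DeJong1996SectionIsDivisor_holds

/-- The target of the owning unit, 4.24 in sufficiency form, now rests on Lemma 3.2 as printed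
and the three local claims B2, B3, B5 of 3.3/3.5. [cite: DeJong1996, 4.24, p. 75] -/
theorem DeJong1996SemiStablePairNormalForm.of_lemma32_of_local (hA : DeJong1996Lemma32.{u})
    (h₂ : DeJong1996SemiStableBoundaryNormalCrossings.{u}) (h₃ : DeJong1996CodimThreeNodalForm.{u})
    (h₅ : DeJong1996CodimThreeSingularComponentsRegular.{u}) :
    DeJong1996SemiStablePairNormalForm.{u} :=
  DeJong1996SemiStablePairNormalForm.of_codimThree_of_parts
    (DeJong1996SemiStableCodimThree.of_lemma32 hA) DeJong1996SemiStableBoundaryIsDivisor_holds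
    h₂ h₃ h₅

end Literature.AlgebraicGeometry.Resolution

end
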